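import Literature.NumberTheory.LFunctions.SelbergShortIntervalDensity
import Literature.NumberTheory.LFunctions.ZeroDensityInghamHuxley
import HarnessLib

/-!
# Selberg's zero-density theorem near the critical line: `N(σ, T) ≪ T^{1 − κ(σ − 1/2)} log T`

Topic `Literature/NumberTheory/LFunctions`. Everything in this file is PROVED (theorems only; no
definitions, no named facts).

Titchmarsh's Theorem 9.19 (C) (Selberg 1946, Theorem 1): *`N(σ, T) = O(T^{1 − (σ − 1/2)/4} log T)`
uniformly for `1/2 ≤ σ ≤ 1`.* Titchmarsh states the theorem without proof; the tree proves the
underlying short-interval estimate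
`Literature.NumberTheory.LFunctions.TwistedMoment.sum_zetaZeroOrder_le_of_meanSquare`
(`SelbergShortIntervalDensity.lean`: Littlewood's lemma for `ζψ_X` on a window of height `≍ V`,
the Gaussian-weighted mollified mean square interpolated by convexity) together with the
critical-line mean square
`Literature.NumberTheory.LFunctions.TwistedMoment.meanSquare_zetaMollifierG_half_le`
(`MollifiedZetaMeanSquares.lean`). This file assembles them into the **global form with an
unspecified exponent**:

* `selberg_zeroDensity_near_half` — there are `κ > 0`, `C`, `T₀` with
  `N(σ, T) ≤ C T^{1 − κ(σ − 1/2)} log T` for all `T ≥ T₀`, `1/2 ≤ σ ≤ 1` (here `κ = 1/4000`).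

This is exactly the hypothesis `hD` of
`Literature.NumberTheory.LFunctions.SelbergMeanSquare.approxFormula_meanSquare_of_zeroDensity`
(`SelbergApproxFormulaMeanSquare.lean`), whence the Selberg–Fujii gap facts.

**Proof.** Put `X = T^{1/200}`, `W = T^{19/20}`, `V = 2W`, `H₀ = T^{49/50}`, `η = σ − 1/2`. For
`η < 1/log T` the claim is the trivial bound `N(σ, T) ≤ N(1/4, T) ≪ T log T`
(`exists_zetaZeroCountRe_le_mul_log`). For `η ≥ 1/log T`: the zeros with `γ ≤ H₀` are at most
`N(1/4, H₀) ≪ T^{49/50} log T`; the zeros with `H₀ < γ ≤ T` are covered by the `⌈(T − H₀)/W⌉`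
windows `(H₀ + (j−1)W, H₀ + (j+1)W)` (`sum_le_of_windows`), on each of which the short-interval
estimate with centre `T₀ = H₀ + jW` and the mean-square bound `∫|G|² ≤ K W` (`meanSquare_le`: all
error terms of `meanSquare_zetaMollifierG_half_le` are `O(W)` in this range) gives
`≪ η⁻¹ (W X^{−η/20} + W X^{−1/2} + log T)` (`window_count_le`); summing,
`N ≪ η⁻¹ (T^{1 − η/4000} + T^{1/20} log T) ≪ T^{1 − η/4000} log T`.

## References

* A. Selberg, *Contributions to the theory of the Riemann zeta-function*, Arch. Math. Naturvid. 48
  (1946) no. 5, Theorem 1.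
* E. C. Titchmarsh, *The Theory of the Riemann Zeta-Function*, 2nd ed. rev. D. R. Heath-Brown (1986),
  Theorem 9.19 (C), §9.24. [cite: Titchmarsh1986, Thm. 9.19 (C)]
-/

noncomputable section

open Real MeasureTheory Set Complex
open scoped ComplexConjugate

namespace Literature.NumberTheory.LFunctions

namespace SelbergDensity

open Literature.NumberTheory.LFunctions.TwistedMoment

/-! ### §1 Covering `(H, T]` by overlapping windows -/

/-- **Covering by windows.** Let `W > 0`, `J = ⌈(T − H)/W⌉`. Every `γ ∈ (H, T]` lies strictly inside
the window `(H + (j−1)W, H + (j+1)W)` with `j = ⌈(γ − H)/W⌉ ∈ [1, J]`. Hence, if a non-negative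
weight `m` summed over any finite set of points lying in one window (and satisfying `P`) is at most
`D`, then over any finite set of points of `(H, T]` satisfying `P` it is at most `J · D`. [folklore] -/
theorem sum_le_of_windows {H T W D : ℝ} (hW : 0 < W) {P : ℂ → Prop} {m : ℂ → ℝ}
    (hblock : ∀ j : ℕ, 1 ≤ j → (j : ℝ) ≤ ⌈(T - H) / W⌉₊ → ∀ Z₀ : Finset ℂ,
      (∀ ρ ∈ Z₀, P ρ ∧ H + ((j : ℝ) - 1) * W < ρ.im ∧ ρ.im < H + ((j : ℝ) + 1) * W) →
      ∑ ρ ∈ Z₀, m ρ ≤ D)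
    (Z : Finset ℂ) (hZ : ∀ ρ ∈ Z, P ρ ∧ H < ρ.im ∧ ρ.im ≤ T) :
    ∑ ρ ∈ Z, m ρ ≤ (⌈(T - H) / W⌉₊ : ℝ) * D := by
  classical
  set J := ⌈(T - H) / W⌉₊ with hJ
  set idx : ℂ → ℕ := fun ρ => ⌈(ρ.im - H) / W⌉₊ with hidx
  have hidx_mem : ∀ ρ ∈ Z, idx ρ ∈ Finset.Icc 1 J := by
    intro ρ hρ
    obtain ⟨-, h1, h2⟩ := hZ ρ hρ
    rw [Finset.mem_Icc]
    constructor
    · exact Nat.one_le_iff_ne_zero.2 (Nat.pos_iff_ne_zero.1 (Nat.ceil_pos.2 (div_pos (sub_pos.2 h1) hW)))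
    · exact Nat.ceil_mono (div_le_div_of_nonneg_right (by linarith only [h2]) hW.le)
  have hwin : ∀ ρ ∈ Z, H + ((idx ρ : ℝ) - 1) * W < ρ.im ∧ ρ.im < H + ((idx ρ : ℝ) + 1) * W := by
    intro ρ hρ
    obtain ⟨-, h1, _⟩ := hZ ρ hρ
    have hpos : 0 < (ρ.im - H) / W := div_pos (by linarith only [h1]) hW
    have hc1 := Nat.ceil_lt_add_one hpos.le
    have hc2 := Nat.le_ceil ((ρ.im - H) / W)
    simp only [hidx]
    constructor
    · have : ((⌈(ρ.im - H) / W⌉₊ : ℝ) - 1) * W < (ρ.im - H) / W * W :=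
        mul_lt_mul_of_pos_right (by linarith only [hc1]) hW
      rw [div_mul_cancel₀ _ hW.ne'] at this; linarith only [this]
    · have : (ρ.im - H) / W * W < ((⌈(ρ.im - H) / W⌉₊ : ℝ) + 1) * W :=
        mul_lt_mul_of_pos_right (by linarith only [hc2]) hW
      rw [div_mul_cancel₀ _ hW.ne'] at this; linarith only [this]
  calc ∑ ρ ∈ Z, m ρ = ∑ j ∈ Finset.Icc 1 J, ∑ ρ ∈ Z.filter (fun ρ => idx ρ = j), m ρ :=
        (Finset.sum_fiberwise_of_maps_to hidx_mem _).symm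
    _ ≤ ∑ j ∈ Finset.Icc 1 J, D := by
        refine Finset.sum_le_sum fun j hj => ?_
        rw [Finset.mem_Icc] at hj
        refine hblock j hj.1 (by exact_mod_cast hj.2) _ fun ρ hρ => ?_
        rw [Finset.mem_filter] at hρ
        obtain ⟨hw1, hw2⟩ := hwin ρ hρ.1
        rw [hρ.2] at hw1 hw2
        exact ⟨(hZ ρ hρ.1).1, hw1, hw2⟩
    _ = (J : ℝ) * D := by
        rw [Finset.sum_const, Nat.card_Icc, nsmul_eq_mul]
        simp

/-! ### §2 Elementary facts about powers of `T` -/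

/-- The universal threshold used below: `B = 20000^{200}`. From `B ≤ T`, `e ≥ 1/200` and `c ≤ 20000`:
`c ≤ T^e`. [folklore] -/
theorem le_rpow_of_big {T e c : ℝ} (hT : (20000 : ℝ) ^ (200 : ℝ) ≤ T) (he : 1 / 200 ≤ e) (hc : c ≤ 20000) :
    c ≤ T ^ e := by
  have hB0 : (0 : ℝ) ≤ (20000 : ℝ) ^ (200 : ℝ) := Real.rpow_nonneg (by norm_num) _
  have he0 : 0 ≤ e := le_trans (by norm_num) he
  calc c ≤ 20000 := hc
    _ = (20000 : ℝ) ^ (1 : ℝ) := (Real.rpow_one _).symm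
    _ ≤ (20000 : ℝ) ^ (200 * e) := Real.rpow_le_rpow_of_exponent_le (by norm_num) (by linarith only [he])
    _ = ((20000 : ℝ) ^ (200 : ℝ)) ^ e := by rw [Real.rpow_mul (by norm_num)]
    _ ≤ T ^ e := Real.rpow_le_rpow hB0 hT he0

/-- `T ≥ B` implies `T ≥ 20000` and `log T ≥ 9`. [folklore] -/
theorem big_facts {T : ℝ} (hT : (20000 : ℝ) ^ (200 : ℝ) ≤ T) : 20000 ≤ T ∧ 9 ≤ Real.log T := by
  have h1 : (20000 : ℝ) ≤ T := by
    have := le_rpow_of_big hT (by norm_num : (1 : ℝ) / 200 ≤ 1) le_rfl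
    rwa [Real.rpow_one] at this
  refine ⟨h1, ?_⟩
  have h2 : Real.exp 9 ≤ 20000 := by
    have := Real.exp_one_lt_d9
    have h3 : Real.exp 9 = (Real.exp 1) ^ 9 := by rw [← Real.exp_nat_mul]; norm_num
    rw [h3]
    have h4 : Real.exp 1 < 3 := by linarith only [this]
    calc Real.exp 1 ^ 9 ≤ 3 ^ 9 := pow_le_pow_left₀ (Real.exp_pos 1).le h4.le 9
      _ ≤ 20000 := by norm_num
  rw [← Real.log_exp 9]
  exact Real.log_le_log (Real.exp_pos 9) (h2.trans h1)

/-- `k · log T ≤ T^{2e}` once `T^e ≥ k/e` (`T, e > 0`, `k ≥ 0`). [folklore] -/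
theorem mul_log_le_rpow {T e k : ℝ} (hT : 0 < T) (he : 0 < e) (hk : 0 ≤ k) (hTe : k / e ≤ T ^ e) :
    k * Real.log T ≤ T ^ (2 * e) := by
  have h1 : Real.log T ≤ T ^ e / e := Real.log_le_rpow_div hT.le he
  have h2 : 0 ≤ T ^ e := Real.rpow_nonneg hT.le _
  have h3 : T ^ (2 * e) = T ^ e * T ^ e := by rw [two_mul, Real.rpow_add hT]
  rw [h3]
  rcases le_or_gt (Real.log T) 0 with hl | hl
  · calc k * Real.log T ≤ 0 := mul_nonpos_of_nonneg_of_nonpos hk hl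
      _ ≤ T ^ e * T ^ e := mul_nonneg h2 h2
  · calc k * Real.log T ≤ k * (T ^ e / e) := mul_le_mul_of_nonneg_left h1 hk
      _ = k / e * T ^ e := by ring
      _ ≤ T ^ e * T ^ e := mul_le_mul_of_nonneg_right hTe h2

/-! ### §3 The mean square of `G_{X,T₀,V}` on the critical line is `O(T^{19/20})` -/

/-- **The critical-line mean square in Selberg's range.** There are `K ≥ 2` and `T₁` such that for
`T ≥ T₁`, `X = T^{1/200}`, `V = 2 T^{19/20}` and every centre `T₀ ∈ [T^{49/50}, 3T]`:
`∫ |G_{X,T₀,V}(1/2+iy)|² dy ≤ K · T^{19/20}` — by `meanSquare_zetaMollifierG_half_le` with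
`ε = 1/(X(1 + log T₀))`, all its terms being `O(T^{19/20})` there. [cite: Titchmarsh1986, §9.24] -/
theorem meanSquare_le : ∃ K T₁ : ℝ, 2 ≤ K ∧ ∀ T : ℝ, T₁ ≤ T → ∀ T₀ : ℝ, T ^ (49 / 50 : ℝ) ≤ T₀ → T₀ ≤ 3 * T →
    ∫ y : ℝ, ‖zetaMollifierG (T ^ (1 / 200 : ℝ)) T₀ (2 * T ^ (19 / 20 : ℝ)) ((1 / 2 : ℝ) + y * I)‖ ^ 2 ≤
      K * T ^ (19 / 20 : ℝ) := by
  obtain ⟨C₅, t₅, hC₅, ht₅, hS1⟩ := meanSquare_zetaMollifierG_half_le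
  set T₁ : ℝ := max ((20000 : ℝ) ^ (200 : ℝ)) ((2 * t₅) ^ (1 / (49 / 50 : ℝ))) with hT₁
  refine ⟨812 * C₅ + 2, T₁, by linarith only [hC₅], fun T hT T₀ hT₀1 hT₀2 ↦ ?_⟩
  have hBig : (20000 : ℝ) ^ (200 : ℝ) ≤ T := le_trans (le_max_left _ _) hT
  have ht5T : (2 * t₅) ^ (1 / (49 / 50 : ℝ)) ≤ T := le_trans (le_max_right _ _) hT
  obtain ⟨hT20000, hL9⟩ := big_facts hBig
  have hT0 : 0 < T := by linarith only [hT20000]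
  have hT1 : 1 ≤ T := by linarith only [hT20000]
  -- the powers
  set X : ℝ := T ^ (1 / 200 : ℝ) with hX
  set W : ℝ := T ^ (19 / 20 : ℝ) with hW
  set H₀ : ℝ := T ^ (49 / 50 : ℝ) with hH₀
  set L : ℝ := Real.log T with hL
  have hX0 : 0 < X := Real.rpow_pos_of_pos hT0 _
  have hW0 : 0 < W := Real.rpow_pos_of_pos hT0 _
  have hH₀0 : 0 < H₀ := Real.rpow_pos_of_pos hT0 _
  have hX1 : 1 ≤ X := Real.one_le_rpow hT1 (by norm_num)
  have hW1 : 1 ≤ W := Real.one_le_rpow hT1 (by norm_num)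
  have hL0 : 0 ≤ L := by linarith only [hL9]
  have hT₀0 : 0 < T₀ := lt_of_lt_of_le hH₀0 hT₀1
  -- rpow identities
  have hX2 : X ^ 2 = T ^ (1 / 100 : ℝ) := by
    rw [hX, ← Real.rpow_natCast, ← Real.rpow_mul hT0.le]; norm_num
  have hX3 : X ^ 3 = T ^ (3 / 200 : ℝ) := by
    rw [hX, ← Real.rpow_natCast, ← Real.rpow_mul hT0.le]; norm_num
  have hW2 : W ^ 2 = T ^ (19 / 10 : ℝ) := by
    rw [hW, ← Real.rpow_natCast, ← Real.rpow_mul hT0.le]; norm_num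
  have hsqrtH : Real.sqrt H₀ = T ^ (49 / 100 : ℝ) := by
    rw [Real.sqrt_eq_rpow, hH₀, ← Real.rpow_mul hT0.le]; norm_num
  have hsqrtT₀ : T ^ (49 / 100 : ℝ) ≤ Real.sqrt T₀ := by rw [← hsqrtH]; exact Real.sqrt_le_sqrt hT₀1
  have h49 : 0 < T ^ (49 / 100 : ℝ) := Real.rpow_pos_of_pos hT0 _
  -- `log T₀ ≤ 2L`, `1 + log T₀ ≤ 3L`
  have hlogT₀ : Real.log T₀ ≤ 2 * L := by
    have h1 : Real.log T₀ ≤ Real.log (3 * T) := Real.log_le_log hT₀0 hT₀2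
    rw [Real.log_mul (by norm_num) hT0.ne'] at h1
    have h2 : Real.log 3 ≤ 2 := by have := Real.log_le_sub_one_of_pos (show (0 : ℝ) < 3 by norm_num); linarith only [this]
    linarith only [h1, h2, hL9]
  have hlogT₀0 : 0 ≤ Real.log T₀ := Real.log_nonneg (le_trans (Real.one_le_rpow hT1 (by norm_num)) hT₀1)
  have h1log : 1 + Real.log T₀ ≤ 3 * L := by linarith only [hlogT₀, hL9]
  have h1log0 : 1 ≤ 1 + Real.log T₀ := by linarith only [hlogT₀0]
  -- hypotheses of the mean-square theorem
  have ht₅ : t₅ ≤ T₀ / 2 := by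
    have h1 : 2 * t₅ ≤ T ^ (49 / 50 : ℝ) :=
      le_trans (le_of_eq (by rw [← Real.rpow_mul (by linarith only [ht₅]), one_div,
        inv_mul_cancel₀ (by norm_num : (49 / 50 : ℝ) ≠ 0), Real.rpow_one]))
        (Real.rpow_le_rpow (Real.rpow_nonneg (by linarith only [ht₅]) _) ht5T (by norm_num))
    linarith only [h1, hT₀1]
  have hX3le : 3 ≤ X := le_rpow_of_big hBig le_rfl (by norm_num)
  have hX25 : 25 ≤ X := le_rpow_of_big hBig le_rfl (by norm_num)
  have hfloor : 4 * X ≤ (⌊Real.sqrt (T₀ / (4 * π))⌋₊ : ℝ) := by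
    -- `√(T₀/4π) ≥ √H₀/4 = T^{0.49}/4 ≥ 5X ≥ 4X + 1`
    have hpi4 : 4 * π ≤ 16 := by have := Real.pi_lt_four; linarith only [this]
    have hs : Real.sqrt H₀ / 4 ≤ Real.sqrt (T₀ / (4 * π)) := by
      rw [show Real.sqrt H₀ / 4 = Real.sqrt (H₀ / 16) by
        rw [Real.sqrt_div hH₀0.le, show (16 : ℝ) = 4 ^ 2 by norm_num, Real.sqrt_sq (by norm_num)]]
      exact Real.sqrt_le_sqrt (by
        rw [div_le_div_iff₀ (by norm_num) (by positivity)]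
        nlinarith only [hT₀1, hpi4, hH₀0])
    have h20 : 20 ≤ T ^ (97 / 200 : ℝ) := le_rpow_of_big hBig (by norm_num) (by norm_num)
    have h5X : 5 * X ≤ Real.sqrt H₀ / 4 := by
      rw [hsqrtH, le_div_iff₀ (by norm_num : (0 : ℝ) < 4)]
      have e : T ^ (49 / 100 : ℝ) = X * T ^ (97 / 200 : ℝ) := by
        rw [hX, ← Real.rpow_add hT0]; norm_num
      rw [e]; nlinarith only [h20, hX0]
    have hfl := Nat.sub_one_lt_floor (Real.sqrt (T₀ / (4 * π)))
    linarith only [hs, h5X, hfl, hX1]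
  have hV3 : 3 ≤ 2 * W := by linarith only [hW1, le_rpow_of_big hBig (by norm_num : (1:ℝ)/200 ≤ 19/20) (by norm_num : (2:ℝ) ≤ 20000)]
  have hV4 : 2 * W ≤ T₀ / 4 := by
    have h8 : 8 ≤ T ^ (3 / 100 : ℝ) := le_rpow_of_big hBig (by norm_num) (by norm_num)
    have e : H₀ = W * T ^ (3 / 100 : ℝ) := by rw [hH₀, hW, ← Real.rpow_add hT0]; norm_num
    have : 8 * W ≤ H₀ := by rw [e]; nlinarith only [h8, hW0]
    linarith only [this, hT₀1]
  set ε : ℝ := 1 / (X * (1 + Real.log T₀)) with hε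
  have hε0 : 0 < ε := by rw [hε]; positivity
  have hε1 : ε ≤ 1 := by
    rw [hε, div_le_one (by positivity)]; nlinarith only [hX1, h1log0]
  -- the mean-square theorem
  have hS := hS1 T₀ X (2 * W) ε ht₅ hX3le hfloor hV3 hV4 hε0 hε1
  -- bounding the terms
  have hlogX : Real.log X = L / 200 := by rw [hX, Real.log_rpow hT0, hL]; ring
  have hterm0 : 2 * W * (1 + Real.log T₀ / Real.log X) ≤ 802 * W := by
    rw [hlogX]
    have : Real.log T₀ / (L / 200) ≤ 400 := by
      rw [div_le_iff₀ (by linarith only [hL9])]; linarith only [hlogT₀]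
    nlinarith only [this, hW0]
  -- (E1) `X T₀^{0.9} ≤ W`
  have hE1 : X * T₀ ^ (9 / 10 : ℝ) ≤ W := by
    have h1 : T₀ ^ (9 / 10 : ℝ) ≤ (3 * T) ^ (9 / 10 : ℝ) := Real.rpow_le_rpow hT₀0.le hT₀2 (by norm_num)
    have h2 : (3 * T) ^ (9 / 10 : ℝ) ≤ 3 * T ^ (9 / 10 : ℝ) := by
      rw [Real.mul_rpow (by norm_num) hT0.le]
      refine mul_le_mul_of_nonneg_right ?_ (Real.rpow_nonneg hT0.le _)
      calc (3 : ℝ) ^ (9 / 10 : ℝ) ≤ (3 : ℝ) ^ (1 : ℝ) := Real.rpow_le_rpow_of_exponent_le (by norm_num) (by norm_num)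
        _ = 3 := Real.rpow_one _
    have h3 : 3 ≤ T ^ (9 / 200 : ℝ) := le_rpow_of_big hBig (by norm_num) (by norm_num)
    have e : W = X * T ^ (9 / 10 : ℝ) * T ^ (9 / 200 : ℝ) := by
      rw [hW, hX, ← Real.rpow_add hT0, ← Real.rpow_add hT0]; norm_num
    rw [e]
    have h4 : 0 ≤ X * T ^ (9 / 10 : ℝ) := by positivity
    calc X * T₀ ^ (9 / 10 : ℝ) ≤ X * (3 * T ^ (9 / 10 : ℝ)) := mul_le_mul_of_nonneg_left (h1.trans h2) hX0.le
      _ = X * T ^ (9 / 10 : ℝ) * 3 := by ring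
      _ ≤ X * T ^ (9 / 10 : ℝ) * T ^ (9 / 200 : ℝ) := mul_le_mul_of_nonneg_left h3 h4
  -- (E2) `X · X^{3/2} √T₀ (1 + log T₀)² ≤ W`
  have hE2 : X * (X ^ (3 / 2 : ℝ) * Real.sqrt T₀ * (1 + Real.log T₀) ^ 2) ≤ W := by
    have h1 : X ^ (3 / 2 : ℝ) ≤ X ^ 2 := by
      rw [← Real.rpow_natCast]
      exact Real.rpow_le_rpow_of_exponent_le hX1 (by norm_num)
    have h2 : Real.sqrt T₀ ≤ 2 * Real.sqrt T := by
      calc Real.sqrt T₀ ≤ Real.sqrt (3 * T) := Real.sqrt_le_sqrt hT₀2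
        _ ≤ Real.sqrt (4 * T) := Real.sqrt_le_sqrt (by linarith only [hT0])
        _ = 2 * Real.sqrt T := by
            rw [Real.sqrt_mul (by norm_num), show (4 : ℝ) = 2 ^ 2 by norm_num, Real.sqrt_sq (by norm_num)]
    have h3 : (1 + Real.log T₀) ^ 2 ≤ 9 * L ^ 2 := by nlinarith only [h1log, h1log0]
    -- `18 L² ≤ T^{87/200}`: `L ≤ 10 T^{1/10}`
    have hL10 : L ≤ T ^ (1 / 10 : ℝ) / (1 / 10) := Real.log_le_rpow_div hT0.le (by norm_num)
    have h1800 : 1800 ≤ T ^ (47 / 200 : ℝ) := le_rpow_of_big hBig (by norm_num) (by norm_num)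
    have hsqrtTe : Real.sqrt T = T ^ (1 / 2 : ℝ) := Real.sqrt_eq_rpow T
    have e : W = T ^ (3 / 200 : ℝ) * T ^ (1 / 2 : ℝ) * (T ^ (1 / 10 : ℝ) * T ^ (1 / 10 : ℝ)) * T ^ (47 / 200 : ℝ) := by
      rw [hW, ← Real.rpow_add hT0, ← Real.rpow_add hT0, ← Real.rpow_add hT0, ← Real.rpow_add hT0]; norm_num
    have h0a : 0 ≤ T ^ (3 / 200 : ℝ) := Real.rpow_nonneg hT0.le _
    have h0b : 0 ≤ T ^ (1 / 2 : ℝ) := Real.rpow_nonneg hT0.le _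
    have h0c : 0 ≤ T ^ (1 / 10 : ℝ) := Real.rpow_nonneg hT0.le _
    calc X * (X ^ (3 / 2 : ℝ) * Real.sqrt T₀ * (1 + Real.log T₀) ^ 2)
        ≤ X * (X ^ 2 * (2 * Real.sqrt T) * (9 * L ^ 2)) := by
          refine mul_le_mul_of_nonneg_left ?_ hX0.le
          exact mul_le_mul (mul_le_mul h1 h2 (Real.sqrt_nonneg _) (by positivity)) h3 (by positivity) (by positivity)
      _ = T ^ (3 / 200 : ℝ) * T ^ (1 / 2 : ℝ) * (18 * L ^ 2) := by rw [← hX3, hsqrtTe]; ring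
      _ ≤ T ^ (3 / 200 : ℝ) * T ^ (1 / 2 : ℝ) * (18 * (T ^ (1 / 10 : ℝ) / (1 / 10)) ^ 2) := by
          have : L ^ 2 ≤ (T ^ (1 / 10 : ℝ) / (1 / 10)) ^ 2 := pow_le_pow_left₀ hL0 hL10 2
          have h00 : 0 ≤ T ^ (3 / 200 : ℝ) * T ^ (1 / 2 : ℝ) := by positivity
          nlinarith only [this, h00]
      _ = T ^ (3 / 200 : ℝ) * T ^ (1 / 2 : ℝ) * (T ^ (1 / 10 : ℝ) * T ^ (1 / 10 : ℝ)) * 1800 := by ring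
      _ ≤ T ^ (3 / 200 : ℝ) * T ^ (1 / 2 : ℝ) * (T ^ (1 / 10 : ℝ) * T ^ (1 / 10 : ℝ)) * T ^ (47 / 200 : ℝ) :=
          mul_le_mul_of_nonneg_left h1800 (by positivity)
      _ = W := e.symm
  -- (E3) `X √X V²/T₀ ≤ W`
  have hE3 : X * (Real.sqrt X * (2 * W) ^ 2 / T₀) ≤ W := by
    have h1 : Real.sqrt X ≤ X := by
      rw [Real.sqrt_le_left hX0.le]; nlinarith only [hX1]
    have h2 : (2 * W) ^ 2 / T₀ ≤ 4 * W ^ 2 / H₀ := by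
      rw [mul_pow, show (2 : ℝ) ^ 2 = 4 by norm_num]
      exact div_le_div_of_nonneg_left (by positivity) hH₀0 hT₀1
    have h4 : 4 ≤ T ^ (1 / 50 : ℝ) := le_rpow_of_big hBig (by norm_num) (by norm_num)
    have e1 : X ^ 2 * W ^ 2 / H₀ = T ^ (93 / 100 : ℝ) := by
      rw [hX2, hW2, hH₀, ← Real.rpow_add hT0, ← Real.rpow_sub hT0]; norm_num
    have e2 : W = T ^ (93 / 100 : ℝ) * T ^ (1 / 50 : ℝ) := by rw [hW, ← Real.rpow_add hT0]; norm_num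
    have h93 : 0 ≤ T ^ (93 / 100 : ℝ) := Real.rpow_nonneg hT0.le _
    calc X * (Real.sqrt X * (2 * W) ^ 2 / T₀) = X * Real.sqrt X * ((2 * W) ^ 2 / T₀) := by ring
      _ ≤ X * X * (4 * W ^ 2 / H₀) :=
          mul_le_mul (mul_le_mul_of_nonneg_left h1 hX0.le) h2 (by positivity) (by positivity)
      _ = 4 * (X ^ 2 * W ^ 2 / H₀) := by ring
      _ = 4 * T ^ (93 / 100 : ℝ) := by rw [e1]
      _ ≤ T ^ (1 / 50 : ℝ) * T ^ (93 / 100 : ℝ) := mul_le_mul_of_nonneg_right h4 h93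
      _ = W := by rw [e2]; ring
  -- (E4) `X · X · V/√T₀ ≤ W`
  have hE4 : X * (X * (2 * W) / Real.sqrt T₀) ≤ W := by
    have h2 : 2 ≤ T ^ (12 / 25 : ℝ) := le_rpow_of_big hBig (by norm_num) (by norm_num)
    have e1 : X ^ 2 * W / T ^ (49 / 100 : ℝ) = T ^ (47 / 100 : ℝ) := by
      rw [hX2, hW, ← Real.rpow_add hT0, ← Real.rpow_sub hT0]; norm_num
    have e2 : W = T ^ (12 / 25 : ℝ) * T ^ (47 / 100 : ℝ) := by rw [hW, ← Real.rpow_add hT0]; norm_num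
    have h47 : 0 ≤ T ^ (47 / 100 : ℝ) := Real.rpow_nonneg hT0.le _
    calc X * (X * (2 * W) / Real.sqrt T₀) = 2 * (X ^ 2 * W / Real.sqrt T₀) := by ring
      _ ≤ 2 * (X ^ 2 * W / T ^ (49 / 100 : ℝ)) :=
          mul_le_mul_of_nonneg_left (div_le_div_of_nonneg_left (by positivity) h49 hsqrtT₀) (by norm_num)
      _ = 2 * T ^ (47 / 100 : ℝ) := by rw [e1]
      _ ≤ T ^ (12 / 25 : ℝ) * T ^ (47 / 100 : ℝ) := mul_le_mul_of_nonneg_right h2 h47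
      _ = W := e2.symm
  -- (E5) `X ε V (1 + log T₀) = V`
  have hXne : X ≠ 0 := hX0.ne'
  have hlne : 1 + Real.log T₀ ≠ 0 := by linarith only [h1log0]
  have hE5 : X * (ε * (2 * W) * (1 + Real.log T₀)) = 2 * W := by
    rw [hε]; field_simp
  -- (E6) `X ε⁻¹ (1 + V/√T₀ + V²/T₀) ≤ W`
  have hE6 : X * (ε⁻¹ * (1 + 2 * W / Real.sqrt T₀ + (2 * W) ^ 2 / T₀)) ≤ W := by
    have hinvε : ε⁻¹ = X * (1 + Real.log T₀) := by rw [hε, one_div, inv_inv]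
    have e46 : 2 * W / T ^ (49 / 100 : ℝ) = 2 * T ^ (23 / 50 : ℝ) := by
      rw [hW, mul_div_assoc, ← Real.rpow_sub hT0]; norm_num
    have e92 : 4 * W ^ 2 / H₀ = 4 * T ^ (23 / 25 : ℝ) := by
      rw [hW2, hH₀, mul_div_assoc, ← Real.rpow_sub hT0]; norm_num
    have h46le : T ^ (23 / 50 : ℝ) ≤ T ^ (23 / 25 : ℝ) := Real.rpow_le_rpow_of_exponent_le hT1 (by norm_num)
    have h92ge1 : 1 ≤ T ^ (23 / 25 : ℝ) := Real.one_le_rpow hT1 (by norm_num)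
    have ha : 2 * W / Real.sqrt T₀ ≤ 2 * T ^ (23 / 50 : ℝ) := by
      rw [← e46]; exact div_le_div_of_nonneg_left (by positivity) h49 hsqrtT₀
    have hb : (2 * W) ^ 2 / T₀ ≤ 4 * T ^ (23 / 25 : ℝ) := by
      rw [← e92, mul_pow, show (2 : ℝ) ^ 2 = 4 by norm_num]
      exact div_le_div_of_nonneg_left (by positivity) hH₀0 hT₀1
    have hpar : 1 + 2 * W / Real.sqrt T₀ + (2 * W) ^ 2 / T₀ ≤ 7 * T ^ (23 / 25 : ℝ) := by
      linarith only [ha, hb, h46le, h92ge1]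
    have hpar0 : 0 ≤ 1 + 2 * W / Real.sqrt T₀ + (2 * W) ^ 2 / T₀ := by positivity
    have h2100 : 21 / (1 / 100 : ℝ) ≤ T ^ (1 / 100 : ℝ) := by
      have := le_rpow_of_big hBig (by norm_num : (1 : ℝ) / 200 ≤ 1 / 100) (by norm_num : (2100 : ℝ) ≤ 20000)
      norm_num at this ⊢; exact this
    have h21 : 21 * L ≤ T ^ (1 / 50 : ℝ) := by
      have := mul_log_le_rpow hT0 (by norm_num : (0 : ℝ) < 1 / 100) (by norm_num : (0 : ℝ) ≤ 21) h2100
      rw [← hL] at this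
      norm_num at this ⊢
      exact this
    have e : W = T ^ (1 / 100 : ℝ) * T ^ (23 / 25 : ℝ) * T ^ (1 / 50 : ℝ) := by
      rw [hW, ← Real.rpow_add hT0, ← Real.rpow_add hT0]; norm_num
    have h01 : 0 ≤ T ^ (1 / 100 : ℝ) := Real.rpow_nonneg hT0.le _
    have h092 : 0 ≤ T ^ (23 / 25 : ℝ) := Real.rpow_nonneg hT0.le _
    calc X * (ε⁻¹ * (1 + 2 * W / Real.sqrt T₀ + (2 * W) ^ 2 / T₀))
        = X ^ 2 * (1 + Real.log T₀) * (1 + 2 * W / Real.sqrt T₀ + (2 * W) ^ 2 / T₀) := by rw [hinvε]; ring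
      _ ≤ T ^ (1 / 100 : ℝ) * (3 * L) * (7 * T ^ (23 / 25 : ℝ)) :=
          mul_le_mul (mul_le_mul hX2.le h1log (by linarith only [h1log0]) h01) hpar hpar0 (by positivity)
      _ = T ^ (1 / 100 : ℝ) * T ^ (23 / 25 : ℝ) * (21 * L) := by ring
      _ ≤ T ^ (1 / 100 : ℝ) * T ^ (23 / 25 : ℝ) * T ^ (1 / 50 : ℝ) := mul_le_mul_of_nonneg_left h21 (by positivity)
      _ = W := e.symm
  -- (E7) the Gaussian tail `X (1+V)^7 e^{−(T₀/4V)²} ≤ W`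
  have hE7 : X * (1 + 2 * W) ^ 7 * Real.exp (-(T₀ / (4 * (2 * W))) ^ 2) ≤ W := by
    have hHW : H₀ = T ^ (3 / 100 : ℝ) * W := by rw [hH₀, hW, ← Real.rpow_add hT0]; norm_num
    have h03 : 0 < T ^ (3 / 100 : ℝ) := Real.rpow_pos_of_pos hT0 _
    have hratio : T ^ (3 / 100 : ℝ) / 8 ≤ T₀ / (4 * (2 * W)) := by
      rw [div_le_div_iff₀ (by norm_num) (by positivity)]
      nlinarith only [hT₀1, hHW, hW0]
    have hsq : (T ^ (3 / 100 : ℝ) / 8) ^ 2 ≤ (T₀ / (4 * (2 * W))) ^ 2 :=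
      pow_le_pow_left₀ (by positivity) hratio 2
    have h17067 : 512 / (3 / 100 : ℝ) ≤ T ^ (3 / 100 : ℝ) := by
      have := le_rpow_of_big hBig (by norm_num : (1 : ℝ) / 200 ≤ 3 / 100) (by norm_num : (17067 : ℝ) ≤ 20000)
      norm_num at this ⊢; linarith only [this]
    have h512 : 512 * L ≤ T ^ (3 / 50 : ℝ) := by
      have := mul_log_le_rpow hT0 (by norm_num : (0 : ℝ) < 3 / 100) (by norm_num : (0 : ℝ) ≤ 512) h17067
      rw [← hL] at this
      norm_num at this ⊢
      exact this
    have hsq2 : (T ^ (3 / 100 : ℝ) / 8) ^ 2 = T ^ (3 / 50 : ℝ) / 64 := by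
      rw [div_pow, ← Real.rpow_natCast, ← Real.rpow_mul hT0.le]; norm_num
    have h8L : 8 * L ≤ (T₀ / (4 * (2 * W))) ^ 2 := by
      rw [hsq2] at hsq; linarith only [hsq, h512]
    have hexp : Real.exp (-(T₀ / (4 * (2 * W))) ^ 2) ≤ T ^ (-(8 : ℝ)) := by
      have e : T ^ (-(8 : ℝ)) = Real.exp (-(8 * L)) := by
        rw [Real.rpow_def_of_pos hT0, hL]; congr 1; ring
      rw [e, Real.exp_le_exp]
      linarith only [h8L]
    have hpow7 : (1 + 2 * W) ^ 7 ≤ 2187 * W ^ 7 := by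
      have : 1 + 2 * W ≤ 3 * W := by linarith only [hW1]
      calc (1 + 2 * W) ^ 7 ≤ (3 * W) ^ 7 := pow_le_pow_left₀ (by positivity) this 7
        _ = 2187 * W ^ 7 := by rw [mul_pow]; norm_num
    have hW7 : W ^ 7 = T ^ (133 / 20 : ℝ) := by
      rw [hW, ← Real.rpow_natCast, ← Real.rpow_mul hT0.le]; norm_num
    have eprod : X * W ^ 7 * T ^ (-(8 : ℝ)) = T ^ (-(269 / 200 : ℝ)) := by
      rw [hX, hW7, ← Real.rpow_add hT0, ← Real.rpow_add hT0]; norm_num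
    have hneg : T ^ (-(269 / 200 : ℝ)) ≤ T ^ (-(1 : ℝ)) := Real.rpow_le_rpow_of_exponent_le hT1 (by norm_num)
    have hinv : T ^ (-(1 : ℝ)) = T⁻¹ := Real.rpow_neg_one T
    have hTinv : 2187 * T⁻¹ ≤ 1 := by
      rw [← div_eq_mul_inv, div_le_one hT0]; linarith only [hT20000]
    calc X * (1 + 2 * W) ^ 7 * Real.exp (-(T₀ / (4 * (2 * W))) ^ 2)
        ≤ X * (2187 * W ^ 7) * T ^ (-(8 : ℝ)) :=
          mul_le_mul (mul_le_mul_of_nonneg_left hpow7 hX0.le) hexp (Real.exp_pos _).le (by positivity)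
      _ = 2187 * (X * W ^ 7 * T ^ (-(8 : ℝ))) := by ring
      _ = 2187 * T ^ (-(269 / 200 : ℝ)) := by rw [eprod]
      _ ≤ 2187 * T ^ (-(1 : ℝ)) := mul_le_mul_of_nonneg_left hneg (by norm_num)
      _ ≤ 1 := by rw [hinv]; exact hTinv
      _ ≤ W := hW1
  -- combination
  have hdist : X * (T₀ ^ (9 / 10 : ℝ) + X ^ (3 / 2 : ℝ) * Real.sqrt T₀ * (1 + Real.log T₀) ^ 2 +
      Real.sqrt X * (2 * W) ^ 2 / T₀ + X * (2 * W) / Real.sqrt T₀ + ε * (2 * W) * (1 + Real.log T₀) +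
      ε⁻¹ * (1 + 2 * W / Real.sqrt T₀ + (2 * W) ^ 2 / T₀)) ≤ 7 * W := by
    have e : X * (T₀ ^ (9 / 10 : ℝ) + X ^ (3 / 2 : ℝ) * Real.sqrt T₀ * (1 + Real.log T₀) ^ 2 +
        Real.sqrt X * (2 * W) ^ 2 / T₀ + X * (2 * W) / Real.sqrt T₀ + ε * (2 * W) * (1 + Real.log T₀) +
        ε⁻¹ * (1 + 2 * W / Real.sqrt T₀ + (2 * W) ^ 2 / T₀)) =
        X * T₀ ^ (9 / 10 : ℝ) + X * (X ^ (3 / 2 : ℝ) * Real.sqrt T₀ * (1 + Real.log T₀) ^ 2) +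
        X * (Real.sqrt X * (2 * W) ^ 2 / T₀) + X * (X * (2 * W) / Real.sqrt T₀) +
        X * (ε * (2 * W) * (1 + Real.log T₀)) + X * (ε⁻¹ * (1 + 2 * W / Real.sqrt T₀ + (2 * W) ^ 2 / T₀)) := by
      ring
    rw [e]; linarith only [hE1, hE2, hE3, hE4, hE5, hE6]
  have hinner : 2 * W * (1 + Real.log T₀ / Real.log X) +
      X * (T₀ ^ (9 / 10 : ℝ) + X ^ (3 / 2 : ℝ) * Real.sqrt T₀ * (1 + Real.log T₀) ^ 2 +
        Real.sqrt X * (2 * W) ^ 2 / T₀ + X * (2 * W) / Real.sqrt T₀ + ε * (2 * W) * (1 + Real.log T₀) +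
        ε⁻¹ * (1 + 2 * W / Real.sqrt T₀ + (2 * W) ^ 2 / T₀)) +
      X * (1 + 2 * W) ^ 7 * Real.exp (-(T₀ / (4 * (2 * W))) ^ 2) + 2 * W ≤ 812 * W := by
    linarith only [hterm0, hdist, hE7]
  calc _ ≤ _ := hS
    _ ≤ C₅ * (812 * W) := mul_le_mul_of_nonneg_left hinner hC₅.le
    _ ≤ (812 * C₅ + 2) * W := by nlinarith only [hW0.le, hC₅]


/-! ### §4 The count in one window -/

/-- **Zeros with `β ≥ 1/2 + η` in one window `(H₀ + (j−1)W, H₀ + (j+1)W)`** (`W = T^{19/20}`,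
`H₀ = T^{49/50}`, `X = T^{1/200}`): by `sum_zetaZeroOrder_le_of_meanSquare` with centre `T₀ = H₀ + jW`,
`V = 2W`, `B₁ = K W` (`meanSquare_le`), the weighted count is at most
`η⁻¹ (K₁ W T^{−η/4000} + 5010 log T)` (`(25/X)^{η/20} ≤ 25 T^{−η/4000}`, `X^{−1/2} ≤ T^{−η/4000}`).
[cite: Titchmarsh1986, §9.19] -/
theorem window_count_le : ∃ K₁ T₂ : ℝ, 0 < K₁ ∧ ∀ T : ℝ, T₂ ≤ T → ∀ η : ℝ, 0 < η → η ≤ 1 →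
    ∀ j : ℕ, 1 ≤ j → (j : ℝ) ≤ ⌈(T - T ^ (49 / 50 : ℝ)) / T ^ (19 / 20 : ℝ)⌉₊ →
    ∀ Z₀ : Finset ℂ, (∀ ρ ∈ Z₀, (riemannZeta ρ = 0 ∧ 1 / 2 + η ≤ ρ.re) ∧
        T ^ (49 / 50 : ℝ) + ((j : ℝ) - 1) * T ^ (19 / 20 : ℝ) < ρ.im ∧
        ρ.im < T ^ (49 / 50 : ℝ) + ((j : ℝ) + 1) * T ^ (19 / 20 : ℝ)) →
      ∑ ρ ∈ Z₀, (riemannZetaZeroOrder ρ : ℝ) ≤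
        (1 / η) * (K₁ * T ^ (19 / 20 : ℝ) * T ^ (-(η / 4000)) + 5010 * Real.log T) := by
  obtain ⟨K, T₁, hK2, hMS⟩ := meanSquare_le
  have hK0 : 0 < K := by linarith only [hK2]
  set T₂ : ℝ := max T₁ ((20000 : ℝ) ^ (200 : ℝ)) with hT₂
  refine ⟨25 * Real.sqrt (66 * K) + 12, T₂, by positivity, fun T hT η hη hη1 j hj1 hjJ Z₀ hZ₀ ↦ ?_⟩
  have hT1' : T₁ ≤ T := le_trans (le_max_left _ _) hT
  have hBig : (20000 : ℝ) ^ (200 : ℝ) ≤ T := le_trans (le_max_right _ _) hT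
  obtain ⟨hT20000, hL9⟩ := big_facts hBig
  have hT0 : 0 < T := by linarith only [hT20000]
  have hT1 : 1 ≤ T := by linarith only [hT20000]
  set X : ℝ := T ^ (1 / 200 : ℝ) with hX
  set W : ℝ := T ^ (19 / 20 : ℝ) with hW
  set H₀ : ℝ := T ^ (49 / 50 : ℝ) with hH₀
  set L : ℝ := Real.log T with hL
  have hX0 : 0 < X := Real.rpow_pos_of_pos hT0 _
  have hW0 : 0 < W := Real.rpow_pos_of_pos hT0 _
  have hH₀0 : 0 < H₀ := Real.rpow_pos_of_pos hT0 _
  have hX1 : 1 ≤ X := Real.one_le_rpow hT1 (by norm_num)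
  have hW2 : 2 ≤ W := le_rpow_of_big hBig (by norm_num) (by norm_num)
  have hW1 : 1 ≤ W := by linarith only [hW2]
  have hH₀4 : 4 ≤ H₀ := le_rpow_of_big hBig (by norm_num) (by norm_num)
  have hH₀T : H₀ ≤ T := by
    calc H₀ = T ^ (49 / 50 : ℝ) := rfl
      _ ≤ T ^ (1 : ℝ) := Real.rpow_le_rpow_of_exponent_le hT1 (by norm_num)
      _ = T := Real.rpow_one T
  have hWT : W ≤ T := by
    calc W = T ^ (19 / 20 : ℝ) := rfl
      _ ≤ T ^ (1 : ℝ) := Real.rpow_le_rpow_of_exponent_le hT1 (by norm_num)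
      _ = T := Real.rpow_one T
  have hX25 : 25 ≤ X := le_rpow_of_big hBig le_rfl (by norm_num)
  -- the window
  set c : ℝ := H₀ + ((j : ℝ) - 1) * W with hc
  set d : ℝ := H₀ + ((j : ℝ) + 1) * W with hd
  set T₀ : ℝ := H₀ + (j : ℝ) * W with hT₀
  have hj1' : (1 : ℝ) ≤ j := by exact_mod_cast hj1
  have hjlt : (j : ℝ) < (T - H₀) / W + 1 := lt_of_le_of_lt hjJ (Nat.ceil_lt_add_one (div_nonneg (by linarith only [hH₀T]) hW0.le))
  have hjW : (j : ℝ) * W < T - H₀ + W := by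
    have := (lt_div_iff₀ hW0).1 (by linarith only [hjlt] : (j : ℝ) - 1 < (T - H₀) / W)
    linarith only [this]
  have hc4 : 4 ≤ c := by rw [hc]; nlinarith only [hH₀4, hj1', hW0]
  have hcd : c ≤ d := by rw [hc, hd]; nlinarith only [hW0]
  have hT₀H : H₀ ≤ T₀ := by rw [hT₀]; nlinarith only [hj1', hW0]
  have hT₀3 : T₀ ≤ 3 * T := by rw [hT₀]; linarith only [hjW, hH₀T, hWT, hT0]
  have hcV : T₀ - 2 * W ≤ c - 1 := by rw [hT₀, hc]; linarith only [hW1]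
  have hdV : d + 1 ≤ T₀ + 2 * W := by rw [hT₀, hd]; linarith only [hW1]
  have hdc : d - c + 2 = 2 * W + 2 := by rw [hd, hc]; ring
  have hd4T : d + 13 ≤ 4 * T := by rw [hd]; linarith only [hjW, hH₀T, hWT, hT20000]
  have hd0 : 0 < d := by linarith only [hc4, hcd]
  -- the mean square and the short-interval estimate
  have hJ := hMS T hT1' T₀ hT₀H hT₀3
  have hV3 : 3 ≤ 2 * W := by linarith only [hW2]
  have hB₁ : 2 * W ≤ K * W := by nlinarith only [hK2, hW0]
  have hZ₀' : ∀ ρ ∈ Z₀, riemannZeta ρ = 0 ∧ 1 / 2 + η ≤ ρ.re ∧ c < ρ.im ∧ ρ.im < d := by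
    intro ρ hρ
    obtain ⟨⟨h1, h2⟩, h3, h4⟩ := hZ₀ ρ hρ
    exact ⟨h1, h2, h3, h4⟩
  have hS2 := sum_zetaZeroOrder_le_of_meanSquare hX25 hV3 hc4 hcd hcV hdV hη hη1 hJ hB₁ Z₀ hZ₀'
  rw [hdc] at hS2
  -- Term A
  set a : ℝ := (25 / X) ^ (η / 20) with ha
  have ha0 : 0 ≤ a := Real.rpow_nonneg (by positivity) _
  have haa : (25 / X) ^ (η / 10) = a ^ 2 := by
    rw [ha, ← Real.rpow_natCast, ← Real.rpow_mul (by positivity)]; congr 1; push_cast; ring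
  have hale : a ≤ 25 * T ^ (-(η / 4000)) := by
    rw [ha, Real.div_rpow (by norm_num) hX0.le]
    have h1 : (25 : ℝ) ^ (η / 20) ≤ 25 := by
      calc (25 : ℝ) ^ (η / 20) ≤ (25 : ℝ) ^ (1 : ℝ) :=
            Real.rpow_le_rpow_of_exponent_le (by norm_num) (by linarith only [hη1])
        _ = 25 := Real.rpow_one _
    have h2 : X ^ (η / 20) = T ^ (η / 4000) := by rw [hX, ← Real.rpow_mul hT0.le]; congr 1; ring
    have h3 : 0 < X ^ (η / 20) := Real.rpow_pos_of_pos hX0 _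
    rw [div_eq_mul_inv, h2, ← Real.rpow_neg hT0.le]
    exact mul_le_mul_of_nonneg_right h1 (Real.rpow_nonneg hT0.le _)
  have hA : Real.sqrt (22 * (K * W * (25 / X) ^ (η / 10)) * (2 * W + 2)) ≤
      Real.sqrt (66 * K) * W * (25 * T ^ (-(η / 4000))) := by
    have h1 : 22 * (K * W * (25 / X) ^ (η / 10)) * (2 * W + 2) ≤ (Real.sqrt (66 * K) * W * a) ^ 2 := by
      rw [haa, mul_pow, mul_pow, Real.sq_sqrt (by positivity)]
      have : 2 * W + 2 ≤ 3 * W := by linarith only [hW2]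
      have h0 : 0 ≤ 22 * (K * W * a ^ 2) := by positivity
      nlinarith only [this, h0]
    calc Real.sqrt (22 * (K * W * (25 / X) ^ (η / 10)) * (2 * W + 2))
        ≤ Real.sqrt ((Real.sqrt (66 * K) * W * a) ^ 2) := Real.sqrt_le_sqrt h1
      _ = Real.sqrt (66 * K) * W * a := Real.sqrt_sq (by positivity)
      _ ≤ Real.sqrt (66 * K) * W * (25 * T ^ (-(η / 4000))) := mul_le_mul_of_nonneg_left hale (by positivity)
  -- Term B
  have hB : 4 * (2 * W + 2) * X ^ (-(1 / 2 : ℝ)) ≤ 12 * W * T ^ (-(η / 4000)) := by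
    have h1 : X ^ (-(1 / 2 : ℝ)) = T ^ (-(1 / 400 : ℝ)) := by rw [hX, ← Real.rpow_mul hT0.le]; norm_num
    have h2 : T ^ (-(1 / 400 : ℝ)) ≤ T ^ (-(η / 4000)) :=
      Real.rpow_le_rpow_of_exponent_le hT1 (by linarith only [hη1])
    have h3 : 4 * (2 * W + 2) ≤ 12 * W := by linarith only [hW2]
    rw [h1]
    exact mul_le_mul h3 h2 (Real.rpow_nonneg hT0.le _) (by positivity)
  -- Term C
  have hC : 5 * (π * (15 * (Real.log 10 + 4 * Real.log (d + 13) + Real.log X) + 1)) + 5 / 2 * π ≤ 5010 * L := by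
    have hpi : π ≤ 4 := Real.pi_lt_four.le
    have hpi0 : 0 < π := Real.pi_pos
    have h10 : Real.log 10 ≤ L := by
      have := Real.log_le_sub_one_of_pos (show (0 : ℝ) < 10 by norm_num); linarith only [this, hL9]
    have hlogd : Real.log (d + 13) ≤ 2 * L := by
      have h1 : Real.log (d + 13) ≤ Real.log (4 * T) := Real.log_le_log (by linarith only [hd0]) hd4T
      rw [Real.log_mul (by norm_num) hT0.ne'] at h1
      have h4 : Real.log 4 ≤ 3 := by have := Real.log_le_sub_one_of_pos (show (0 : ℝ) < 4 by norm_num); linarith only [this]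
      linarith only [h1, h4, hL9]
    have hlogX : Real.log X ≤ L := by
      rw [hX, Real.log_rpow hT0]; nlinarith only [hL9]
    have hin : 15 * (Real.log 10 + 4 * Real.log (d + 13) + Real.log X) + 1 ≤ 151 * L := by
      linarith only [h10, hlogd, hlogX, hL9]
    have hin0 : 0 ≤ 15 * (Real.log 10 + 4 * Real.log (d + 13) + Real.log X) + 1 := by
      have : 0 ≤ Real.log 10 := Real.log_nonneg (by norm_num)
      have : 0 ≤ Real.log (d + 13) := Real.log_nonneg (by linarith only [hd0])
      have : 0 ≤ Real.log X := Real.log_nonneg hX1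
      positivity
    nlinarith only [hpi, hpi0, hin, hin0, hL9]
  -- combination
  have hbr0 : 0 ≤ Real.sqrt (66 * K) * W * (25 * T ^ (-(η / 4000))) + 12 * W * T ^ (-(η / 4000)) + 5010 * L := by
    have : 0 ≤ T ^ (-(η / 4000)) := Real.rpow_nonneg hT0.le _
    have : 0 ≤ L := by linarith only [hL9]
    positivity
  have hπη : 1 / (π * η) ≤ 1 / η := by
    rw [div_le_div_iff₀ (by positivity) hη]
    have := Real.pi_gt_three; nlinarith only [this, hη]
  calc ∑ ρ ∈ Z₀, (riemannZetaZeroOrder ρ : ℝ) ≤ _ := hS2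
    _ ≤ (1 / (π * η)) * (Real.sqrt (66 * K) * W * (25 * T ^ (-(η / 4000))) +
          12 * W * T ^ (-(η / 4000)) + 5010 * L) := by
        refine mul_le_mul_of_nonneg_left ?_ (by positivity)
        linarith only [hA, hB, hC]
    _ ≤ (1 / η) * (Real.sqrt (66 * K) * W * (25 * T ^ (-(η / 4000))) +
          12 * W * T ^ (-(η / 4000)) + 5010 * L) := mul_le_mul_of_nonneg_right hπη hbr0
    _ = (1 / η) * ((25 * Real.sqrt (66 * K) + 12) * W * T ^ (-(η / 4000)) + 5010 * L) := by ring

/-! ### §5 The global density theorem -/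

/-- **Selberg's zero-density theorem near the critical line** (Selberg 1946, Theorem 1; Titchmarsh,
Theorem 9.19 (C): "`N(σ, T) = O(T^{1 − (σ−1/2)/4} log T)` uniformly for `1/2 ≤ σ ≤ 1`"), in the form
with an unspecified exponent: there are `κ > 0` (here `κ = 1/4000`), `C` and `T₀` such that
`N(σ, T) ≤ C T^{1 − κ(σ − 1/2)} log T` for all `T ≥ T₀` and `1/2 ≤ σ ≤ 1`.
[cite: Titchmarsh1986, Thm. 9.19 (C)] -/
theorem selberg_zeroDensity_near_half : ∃ κ : ℝ, 0 < κ ∧ ∃ C T₀ : ℝ, ∀ T : ℝ, T₀ ≤ T →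
    ∀ σ : ℝ, 1 / 2 ≤ σ → σ ≤ 1 →
      (zetaZeroCountRe σ T : ℝ) ≤ C * T ^ (1 - κ * (σ - 1 / 2)) * Real.log T := by
  classical
  obtain ⟨K₁, T₂, hK₁, hWC⟩ := window_count_le
  obtain ⟨Ct, hCt, htriv⟩ := exists_zetaZeroCountRe_le_mul_log
  refine ⟨1 / 4000, by norm_num, 18 * Ct + 2 * K₁ + 2, max T₂ ((20000 : ℝ) ^ (200 : ℝ)),
    fun T hT σ hσ1 hσ2 ↦ ?_⟩
  have hT₂ : T₂ ≤ T := le_trans (le_max_left _ _) hT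
  have hBig : (20000 : ℝ) ^ (200 : ℝ) ≤ T := le_trans (le_max_right _ _) hT
  obtain ⟨hT20000, hL9⟩ := big_facts hBig
  have hT0 : 0 < T := by linarith only [hT20000]
  have hT1 : 1 ≤ T := by linarith only [hT20000]
  set η : ℝ := σ - 1 / 2 with hη
  have hη0 : 0 ≤ η := by rw [hη]; linarith only [hσ1]
  have hη1 : η ≤ 1 := by rw [hη]; linarith only [hσ2]
  set L : ℝ := Real.log T with hL
  set E : ℝ := T ^ (1 - 1 / 4000 * (σ - 1 / 2)) with hE
  have hE0 : 0 < E := Real.rpow_pos_of_pos hT0 _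
  have hEexp : E = T * T ^ (-(η / 4000)) := by
    have h1 : T ^ (1 - 1 / 4000 * (σ - 1 / 2)) = T ^ ((1 : ℝ) + (-(η / 4000))) := by
      congr 1; rw [hη]; ring
    rw [hE, h1, Real.rpow_add hT0, Real.rpow_one]
  have hL0 : 0 < L := by linarith only [hL9]
  -- the trivial bound in the shape `N(σ', T') ≤ 6 Ct T' L` for `1 ≤ T' ≤ T`
  have htriv' : ∀ σ' T' : ℝ, 1 / 4 ≤ σ' → 1 ≤ T' → T' ≤ T → (zetaZeroCountRe σ' T' : ℝ) ≤ 6 * Ct * T' * L := by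
    intro σ' T' hσ' hT' hT'T
    refine (htriv σ' hσ' T' hT').trans ?_
    have h1 : T' + 2 ≤ 2 * T' + 1 := by linarith only [hT']
    have h2 : Real.log (T' + 2) ≤ 2 * L := by
      have h3 : Real.log (T' + 2) ≤ Real.log (3 * T) := Real.log_le_log (by linarith only [hT']) (by linarith only [hT', hT'T])
      rw [Real.log_mul (by norm_num) hT0.ne'] at h3
      have h4 : Real.log 3 ≤ 2 := by have := Real.log_le_sub_one_of_pos (show (0 : ℝ) < 3 by norm_num); linarith only [this]
      linarith only [h3, h4, hL9]
    have h5 : 0 ≤ Real.log (T' + 2) := Real.log_nonneg (by linarith only [hT'])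
    calc Ct * (T' + 2) * Real.log (T' + 2) ≤ Ct * (3 * T') * (2 * L) := by
          refine mul_le_mul (mul_le_mul_of_nonneg_left (by linarith only [hT']) hCt.le) h2 h5 (by positivity)
      _ = 6 * Ct * T' * L := by ring
  rcases lt_or_ge (η * L) 1 with hsmall | hlarge
  · -- Case A: `η < 1/L`: the trivial bound, `T ≤ 3 E`
    have hmono : (zetaZeroCountRe σ T : ℝ) ≤ zetaZeroCountRe (1 / 4) T := by
      exact_mod_cast zetaZeroCountRe_anti_left_holds T (by linarith only [hσ1] : (1 : ℝ) / 4 ≤ σ)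
    have hTE : T ≤ 3 * E := by
      have h1 : T ^ (η / 4000) ≤ 3 := by
        rw [Real.rpow_def_of_pos hT0, ← hL]
        have : Real.log T * (η / 4000) ≤ 1 := by rw [← hL]; nlinarith only [hsmall, hη0, hL0]
        calc Real.exp (L * (η / 4000)) ≤ Real.exp 1 := Real.exp_le_exp.2 this
          _ ≤ 3 := by have := Real.exp_one_lt_d9; linarith only [this]
      have h2 : T = E * T ^ (η / 4000) := by
        rw [hEexp, mul_assoc, ← Real.rpow_add hT0, neg_add_cancel, Real.rpow_zero, mul_one]
      rw [h2]; nlinarith only [h1, hE0]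
    calc (zetaZeroCountRe σ T : ℝ) ≤ zetaZeroCountRe (1 / 4) T := hmono
      _ ≤ 6 * Ct * T * L := htriv' _ _ le_rfl hT1 le_rfl
      _ ≤ 6 * Ct * (3 * E) * L := by
          have : 0 ≤ 6 * Ct * L := by positivity
          nlinarith only [hTE, this]
      _ ≤ (18 * Ct + 2 * K₁ + 2) * E * L := by
          have : 0 ≤ E * L := by positivity
          nlinarith only [this, hK₁]
  · -- Case B: `η ≥ 1/L`
    have hηpos : 0 < η := by
      by_contra h
      push Not at h
      have : η * L ≤ 0 := mul_nonpos_of_nonpos_of_nonneg h hL0.le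
      linarith only [this, hlarge]
    have hinvη : 1 / η ≤ L := by rw [div_le_iff₀ hηpos]; linarith only [hlarge]
    set W : ℝ := T ^ (19 / 20 : ℝ) with hW
    set H₀ : ℝ := T ^ (49 / 50 : ℝ) with hH₀
    have hW0 : 0 < W := Real.rpow_pos_of_pos hT0 _
    have hH₀0 : 0 < H₀ := Real.rpow_pos_of_pos hT0 _
    have hH₀1 : 1 ≤ H₀ := Real.one_le_rpow hT1 (by norm_num)
    have hH₀T : H₀ ≤ T := by
      calc H₀ = T ^ (49 / 50 : ℝ) := rfl
        _ ≤ T ^ (1 : ℝ) := Real.rpow_le_rpow_of_exponent_le hT1 (by norm_num)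
        _ = T := Real.rpow_one T
    have hWT : W ≤ T := by
      calc W = T ^ (19 / 20 : ℝ) := rfl
        _ ≤ T ^ (1 : ℝ) := Real.rpow_le_rpow_of_exponent_le hT1 (by norm_num)
        _ = T := Real.rpow_one T
    have hH₀E : H₀ ≤ E := by
      rw [hE, hH₀]; exact Real.rpow_le_rpow_of_exponent_le hT1 (by linarith only [hη1, hη0, hη])
    -- split `N(σ, T)` at height `H₀`
    rw [natCast_zetaZeroCountRe σ T]
    set F := (zetaZeroBox_finite σ T).toFinset with hF
    rw [← Finset.sum_filter_add_sum_filter_not F (fun ρ ↦ ρ.im ≤ H₀)]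
    -- part 1: `γ ≤ H₀`
    have hpart1 : ∑ ρ ∈ F.filter (fun ρ ↦ ρ.im ≤ H₀), (riemannZetaZeroOrder ρ : ℝ) ≤ 6 * Ct * E * L := by
      have hset : F.filter (fun ρ ↦ ρ.im ≤ H₀) = (zetaZeroBox_finite σ H₀).toFinset := by
        ext ρ
        simp only [Finset.mem_filter, hF, Set.Finite.mem_toFinset, zetaZeroBox, Set.mem_setOf_eq]
        constructor
        · rintro ⟨⟨h1, h2, h3, h4, -⟩, h6⟩; exact ⟨h1, h2, h3, h4, h6⟩
        · rintro ⟨h1, h2, h3, h4, h5⟩; exact ⟨⟨h1, h2, h3, h4, h5.trans hH₀T⟩, h5⟩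
      rw [hset, ← natCast_zetaZeroCountRe σ H₀]
      have hmono : (zetaZeroCountRe σ H₀ : ℝ) ≤ zetaZeroCountRe (1 / 4) H₀ := by
        exact_mod_cast zetaZeroCountRe_anti_left_holds H₀ (by linarith only [hσ1] : (1 : ℝ) / 4 ≤ σ)
      calc (zetaZeroCountRe σ H₀ : ℝ) ≤ zetaZeroCountRe (1 / 4) H₀ := hmono
        _ ≤ 6 * Ct * H₀ * L := htriv' _ _ le_rfl hH₀1 hH₀T
        _ ≤ 6 * Ct * E * L := by
            have : 0 ≤ 6 * Ct * L := by positivity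
            nlinarith only [hH₀E, this]
    -- part 2: `H₀ < γ ≤ T`, by windows
    have hpart2 : ∑ ρ ∈ F.filter (fun ρ ↦ ¬ ρ.im ≤ H₀), (riemannZetaZeroOrder ρ : ℝ) ≤ (2 * K₁ + 2) * E * L := by
      have hcov := sum_le_of_windows (H := H₀) (T := T) (W := W) hW0
        (P := fun ρ ↦ riemannZeta ρ = 0 ∧ 1 / 2 + η ≤ ρ.re) (m := fun ρ ↦ (riemannZetaZeroOrder ρ : ℝ))
        (D := (1 / η) * (K₁ * T ^ (19 / 20 : ℝ) * T ^ (-(η / 4000)) + 5010 * Real.log T))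
        (fun j hj1 hjJ Z₀ hZ₀ ↦ hWC T hT₂ η hηpos hη1 j hj1 hjJ Z₀ hZ₀)
        (F.filter (fun ρ ↦ ¬ ρ.im ≤ H₀)) (by
          intro ρ hρ
          rw [Finset.mem_filter, hF, Set.Finite.mem_toFinset] at hρ
          obtain ⟨⟨h1, h2, -, -, h5⟩, h6⟩ := hρ
          exact ⟨⟨h1, by rw [hη]; linarith only [h2]⟩, lt_of_not_ge h6, h5⟩)
      refine hcov.trans ?_
      -- `J ≤ 2T/W`, `J · D ≤ (2/η)(K₁ E + 5010 T L/W) ≤ 2L (K₁ + 1) E`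
      have hJ : (⌈(T - H₀) / W⌉₊ : ℝ) ≤ 2 * T / W := by
        have h1 := (Nat.ceil_lt_add_one (div_nonneg (sub_nonneg.2 hH₀T) hW0.le)).le
        have h2 : (T - H₀) / W + 1 ≤ 2 * T / W := by
          rw [div_add_one hW0.ne', div_le_div_iff_of_pos_right hW0]; linarith only [hWT, hH₀0]
        exact h1.trans h2
      have hD0 : 0 ≤ (1 / η) * (K₁ * T ^ (19 / 20 : ℝ) * T ^ (-(η / 4000)) + 5010 * Real.log T) := by
        have : 0 ≤ T ^ (-(η / 4000)) := Real.rpow_nonneg hT0.le _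
        have : 0 ≤ Real.log T := by rw [← hL]; exact hL0.le
        positivity
      -- `5010 L T^{1/20} ≤ E`: `5010 L ≤ T^{9/10} ≤ T^{19/20 − η/4000} · …`
      have h5010 : 5010 * L * (T / W) ≤ E := by
        have h11134 : 5010 / (9 / 20 : ℝ) ≤ T ^ (9 / 20 : ℝ) := by
          have := le_rpow_of_big hBig (by norm_num : (1 : ℝ) / 200 ≤ 9 / 20) (by norm_num : (11134 : ℝ) ≤ 20000)
          norm_num at this ⊢; linarith only [this]
        have h1 : 5010 * L ≤ T ^ (9 / 10 : ℝ) := by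
          have := mul_log_le_rpow hT0 (by norm_num : (0 : ℝ) < 9 / 20) (by norm_num : (0 : ℝ) ≤ 5010) h11134
          rw [← hL] at this; norm_num at this ⊢; exact this
        have h2 : T / W = T ^ (1 / 20 : ℝ) := by
          rw [div_eq_iff hW0.ne', hW, ← Real.rpow_add hT0]; norm_num
        have h3 : T ^ (9 / 10 : ℝ) * T ^ (1 / 20 : ℝ) = T ^ (19 / 20 : ℝ) := by
          rw [← Real.rpow_add hT0]; norm_num
        have h4 : T ^ (19 / 20 : ℝ) ≤ E := by
          rw [hE]; exact Real.rpow_le_rpow_of_exponent_le hT1 (by linarith only [hη1, hη0, hη])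
        rw [h2]
        calc 5010 * L * T ^ (1 / 20 : ℝ) ≤ T ^ (9 / 10 : ℝ) * T ^ (1 / 20 : ℝ) :=
              mul_le_mul_of_nonneg_right h1 (Real.rpow_nonneg hT0.le _)
          _ = T ^ (19 / 20 : ℝ) := h3
          _ ≤ E := h4
      have hmain : 2 * T / W * ((1 / η) * (K₁ * T ^ (19 / 20 : ℝ) * T ^ (-(η / 4000)) + 5010 * Real.log T)) ≤
          (2 * K₁ + 2) * E * L := by
        have e1 : 2 * T / W * ((1 / η) * (K₁ * T ^ (19 / 20 : ℝ) * T ^ (-(η / 4000)) + 5010 * Real.log T)) =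
            (1 / η) * (2 * K₁ * (T * T ^ (-(η / 4000))) + 2 * (5010 * L * (T / W))) := by
          rw [← hL, ← hW]; field_simp
        rw [e1, ← hEexp]
        have h2 : 2 * K₁ * E + 2 * (5010 * L * (T / W)) ≤ (2 * K₁ + 2) * E := by nlinarith only [h5010, hK₁]
        have h3 : 0 ≤ 2 * K₁ * E + 2 * (5010 * L * (T / W)) := by positivity
        calc (1 / η) * (2 * K₁ * E + 2 * (5010 * L * (T / W))) ≤ L * ((2 * K₁ + 2) * E) :=
              mul_le_mul hinvη h2 h3 hL0.le
          _ = (2 * K₁ + 2) * E * L := by ring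
      calc (⌈(T - H₀) / W⌉₊ : ℝ) * ((1 / η) * (K₁ * T ^ (19 / 20 : ℝ) * T ^ (-(η / 4000)) + 5010 * Real.log T))
          ≤ 2 * T / W * ((1 / η) * (K₁ * T ^ (19 / 20 : ℝ) * T ^ (-(η / 4000)) + 5010 * Real.log T)) :=
            mul_le_mul_of_nonneg_right hJ hD0
        _ ≤ (2 * K₁ + 2) * E * L := hmain
    calc ∑ ρ ∈ F.filter (fun ρ ↦ ρ.im ≤ H₀), (riemannZetaZeroOrder ρ : ℝ) +
          ∑ ρ ∈ F.filter (fun ρ ↦ ¬ ρ.im ≤ H₀), (riemannZetaZeroOrder ρ : ℝ)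
        ≤ 6 * Ct * E * L + (2 * K₁ + 2) * E * L := add_le_add hpart1 hpart2
      _ ≤ (18 * Ct + 2 * K₁ + 2) * E * L := by
          have : 0 ≤ E * L := by positivity
          nlinarith only [this, hCt]

  

end SelbergDensity

end Literature.NumberTheory.LFunctions

end
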